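import Summits.CriticalPhenomena.PercolationContinuityZ3.Theorems.PercNearOneGluingNoHeavyLowerTailThresholdTwoFibre

/-!
# `NoHeavyLowerTail` (crux stmt-CriticalPhenomena-4575), lane prim-ineq-gen-4 (gen 17): the fibre lemmas for the threshold slot `Θ₂`,
# RELATIVE to a sub-cube `𝒫(Y)`

Support file (`--supports stmt-CriticalPhenomena-4575`; memo `run/shared/lean/prim/prim-ineq-gen-4/FINDING-THRESHOLD-FIBREWISE-g17.md`, proof text
`PROOFS-THRESHOLD-TWO-g17.md`).  Pure finite combinatorics, no definitions, no `sorry`, standard axioms.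

These are the lemmas of `…ThresholdTwoFibre` restated on the cube `𝒫(Y)` of a finset `Y` of an arbitrary type (complements taken inside `Y`),
which is the form in which the spectator-by-spectator certificate for `N(Θ₂,V,W) ≥ 0` consumes them (the fibre over the spectator `S` is the cube
`𝒫(Sᶜ)`, and the traces of the GLOBAL up-sets `W, V` are simply `W, V` filtered to subsets of `Y`).  For a finset `Y`, up-sets `W, V` of finsets:
* `card_cross_le_card_diag` (Kleitman-then-Harris in `𝒫(Y)`, from Mathlib's relative Harris–Kleitman `IsLowerSet.le_card_inter_finset'`):
  `#{z ⊆ Y : z ∈ X, Y \ z ∈ V} ≤ #{u ⊆ Y : u ∈ X ∩ V}`; graded forms `card_cross_two_le`, `card_cross_cotwo_le` (`X = W ∩ Θ₂`, resp. `V ∩ Θ₂`);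
* `card_window_add_singletons_le_rel` (RAB₂): for `3 ≤ #Y`, `#{z ⊆ Y : z ∈ W, Y \ z ∈ V, 2 ≤ #z ≤ #Y − 2} + #{i ∈ Y : {i} ∈ W ∩ V} ≤ #{u ⊆ Y : u ∈ W∩V, 2 ≤ #u}`;
* `card_cross_two_lt_rel` (SK₂, strict Kleitman): for `3 ≤ #Y`, `∅ ∉ V` and a common singleton `{p}`, `p ∈ Y`:
  `#{z ⊆ Y : z ∈ W, 2 ≤ #z, Y \ z ∈ V} < #{u ⊆ Y : u ∈ W ∩ V, 2 ≤ #u}`;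
(The fibre `#Y = 2` and the assembly are in `…ThresholdTwoCount`.)
-/

namespace Summit.CriticalPhenomena.PercolationContinuityZ3.Theorems.ThresholdTwoFibre

open Finset

variable {α : Type*} [DecidableEq α]

/-- For `z ⊆ Y`: `Y \ (Y \ z) = z`. [folklore] -/
theorem sdiff_sdiff_of_subset {Y z : Finset α} (h : z ⊆ Y) : Y \ (Y \ z) = z := Finset.sdiff_sdiff_eq_self h
/-- **Kleitman-then-Harris inside `𝒫(Y)`.**  For up-sets `X, V` of finsets and any finset `Y`:
`#{z ⊆ Y : z ∈ X, Y \ z ∈ V} ≤ #{u ⊆ Y : u ∈ X, u ∈ V}`. [this work] -/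
theorem card_cross_le_card_diag (Y : Finset α) (X V : Finset (Finset α)) (hX : IsUpperSet (X : Set (Finset α)))
    (hV : IsUpperSet (V : Set (Finset α))) :
    #(Y.powerset.filter fun z => z ∈ X ∧ Y \ z ∈ V) ≤ #(Y.powerset.filter fun u => u ∈ X ∧ u ∈ V) := by
  set 𝒜 := Y.powerset.filter fun t => Y \ t ∈ X with h𝒜
  set ℬ := Y.powerset.filter fun t => Y \ t ∈ V with hℬ
  set 𝒞 := Y.powerset.filter fun t => t ∈ V with h𝒞
  set 𝒟 := Y.powerset.filter fun t => t ∉ V with h𝒟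
  have hA : IsLowerSet (𝒜 : Set (Finset α)) := by
    intro t t' htt' ht
    rw [mem_coe, h𝒜, mem_filter, mem_powerset] at ht ⊢
    exact ⟨subset_trans htt' ht.1, hX (sdiff_subset_sdiff (subset_refl Y) htt') ht.2⟩
  have hB : IsLowerSet (ℬ : Set (Finset α)) := by
    intro t t' htt' ht
    rw [mem_coe, hℬ, mem_filter, mem_powerset] at ht ⊢
    exact ⟨subset_trans htt' ht.1, hV (sdiff_subset_sdiff (subset_refl Y) htt') ht.2⟩
  have hD : IsLowerSet (𝒟 : Set (Finset α)) := by
    intro t t' htt' ht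
    rw [mem_coe, h𝒟, mem_filter, mem_powerset] at ht ⊢
    exact ⟨subset_trans htt' ht.1, fun h => ht.2 (hV htt' h)⟩
  have hAs : ∀ t ∈ 𝒜, t ⊆ Y := fun t ht => by rw [h𝒜, mem_filter, mem_powerset] at ht; exact ht.1
  have hBs : ∀ t ∈ ℬ, t ⊆ Y := fun t ht => by rw [hℬ, mem_filter, mem_powerset] at ht; exact ht.1
  have hDs : ∀ t ∈ 𝒟, t ⊆ Y := fun t ht => by rw [h𝒟, mem_filter, mem_powerset] at ht; exact ht.1
  have hcross : #(Y.powerset.filter fun z => z ∈ X ∧ Y \ z ∈ V) = #(𝒜 ∩ 𝒞) := by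
    refine card_bij (fun z _ => Y \ z) (fun z hz => ?_) (fun z hz z' hz' h => ?_) (fun t ht => ?_)
    · rw [mem_filter, mem_powerset] at hz
      rw [mem_inter, h𝒜, h𝒞, mem_filter, mem_filter, mem_powerset, sdiff_sdiff_of_subset hz.1]
      exact ⟨⟨sdiff_subset, hz.2.1⟩, sdiff_subset, hz.2.2⟩
    · rw [mem_filter, mem_powerset] at hz hz'
      rw [← sdiff_sdiff_of_subset hz.1, h, sdiff_sdiff_of_subset hz'.1]
    · rw [mem_inter, h𝒜, h𝒞, mem_filter, mem_filter, mem_powerset] at ht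
      refine ⟨Y \ t, ?_, sdiff_sdiff_of_subset ht.1.1⟩
      rw [mem_filter, mem_powerset, sdiff_sdiff_of_subset ht.1.1]
      exact ⟨sdiff_subset, ht.1.2, ht.2.2⟩
  have hdiag : #(Y.powerset.filter fun u => u ∈ X ∧ u ∈ V) = #(𝒜 ∩ ℬ) := by
    refine card_bij (fun u _ => Y \ u) (fun u hu => ?_) (fun u hu u' hu' h => ?_) (fun t ht => ?_)
    · rw [mem_filter, mem_powerset] at hu
      rw [mem_inter, h𝒜, hℬ, mem_filter, mem_filter, mem_powerset, sdiff_sdiff_of_subset hu.1]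
      exact ⟨⟨sdiff_subset, hu.2.1⟩, sdiff_subset, hu.2.2⟩
    · rw [mem_filter, mem_powerset] at hu hu'
      rw [← sdiff_sdiff_of_subset hu.1, h, sdiff_sdiff_of_subset hu'.1]
    · rw [mem_inter, h𝒜, hℬ, mem_filter, mem_filter, mem_powerset] at ht
      refine ⟨Y \ t, ?_, sdiff_sdiff_of_subset ht.1.1⟩
      rw [mem_filter, mem_powerset]
      exact ⟨sdiff_subset, ht.1.2, ht.2.2⟩
  have hBC : #ℬ = #𝒞 := by
    refine card_bij (fun t _ => Y \ t) (fun t ht => ?_) (fun t ht t' ht' h => ?_) (fun t ht => ?_)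
    · rw [hℬ, mem_filter, mem_powerset] at ht
      rw [h𝒞, mem_filter, mem_powerset]
      exact ⟨sdiff_subset, ht.2⟩
    · rw [hℬ, mem_filter, mem_powerset] at ht ht'
      rw [← sdiff_sdiff_of_subset ht.1, h, sdiff_sdiff_of_subset ht'.1]
    · rw [h𝒞, mem_filter, mem_powerset] at ht
      refine ⟨Y \ t, ?_, sdiff_sdiff_of_subset ht.1⟩
      rw [hℬ, mem_filter, mem_powerset, sdiff_sdiff_of_subset ht.1]
      exact ⟨sdiff_subset, ht.2⟩
  have hCD : #𝒞 + #𝒟 = 2 ^ #Y := by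
    rw [h𝒞, h𝒟, card_filter_add_card_filter_not, card_powerset]
  have hACD : #(𝒜 ∩ 𝒞) + #(𝒜 ∩ 𝒟) = #𝒜 := by
    have e1 : 𝒜 ∩ 𝒞 = 𝒜.filter fun t => t ∈ V := by
      ext t; simp only [h𝒜, h𝒞, mem_inter, mem_filter, mem_powerset]; tauto
    have e2 : 𝒜 ∩ 𝒟 = 𝒜.filter fun t => t ∉ V := by
      ext t; simp only [h𝒜, h𝒟, mem_inter, mem_filter, mem_powerset]; tauto
    rw [e1, e2, card_filter_add_card_filter_not]
  have h1 := hA.le_card_inter_finset' hB hAs hBs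
  have h2 := hA.le_card_inter_finset' hD hAs hDs
  rw [hcross, hdiag]
  have key : 2 ^ #Y * #(𝒜 ∩ 𝒞) + #𝒜 * #𝒟 ≤ 2 ^ #Y * #(𝒜 ∩ ℬ) + #𝒜 * #𝒟 := by
    have e3 : 2 ^ #Y * #(𝒜 ∩ 𝒞) + 2 ^ #Y * #(𝒜 ∩ 𝒟) = #𝒜 * #𝒞 + #𝒜 * #𝒟 := by
      rw [← mul_add, hACD, ← mul_add, hCD, mul_comm]
    rw [hBC] at h1
    omega
  exact Nat.le_of_mul_le_mul_left (Nat.le_of_add_le_add_right key) (Nat.two_pow_pos _)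

/-- **Graded Kleitman in `𝒫(Y)`**: `#{z ⊆ Y : z ∈ W, 2 ≤ #z, Y \ z ∈ V} ≤ #{u ⊆ Y : u ∈ W ∩ V, 2 ≤ #u}`. [this work] -/
theorem card_cross_two_le (Y : Finset α) (W V : Finset (Finset α)) (hW : IsUpperSet (W : Set (Finset α)))
    (hV : IsUpperSet (V : Set (Finset α))) :
    #(Y.powerset.filter fun z => (z ∈ W ∧ 2 ≤ #z) ∧ Y \ z ∈ V)
      ≤ #(Y.powerset.filter fun u => (u ∈ W ∧ u ∈ V) ∧ 2 ≤ #u) := by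
  have h := card_cross_le_card_diag Y (W.filter fun z => 2 ≤ #z) V (isUpperSet_filter_card_le W hW 2) hV
  have e1 : (Y.powerset.filter fun z => z ∈ W.filter (fun z => 2 ≤ #z) ∧ Y \ z ∈ V) =
      Y.powerset.filter fun z => (z ∈ W ∧ 2 ≤ #z) ∧ Y \ z ∈ V := by
    ext z; simp only [mem_filter]
  have e2 : (Y.powerset.filter fun u => u ∈ W.filter (fun z => 2 ≤ #z) ∧ u ∈ V) =
      Y.powerset.filter fun u => (u ∈ W ∧ u ∈ V) ∧ 2 ≤ #u := by
    ext u; simp only [mem_filter]; tauto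
  rw [e1, e2] at h
  exact h

/-- **Graded Kleitman in `𝒫(Y)`, mirror form**: `#{z ⊆ Y : z ∈ W, Y \ z ∈ V, 2 ≤ #(Y \ z)} ≤ #{u ⊆ Y : u ∈ W ∩ V, 2 ≤ #u}`. [this work] -/
theorem card_cross_cotwo_le (Y : Finset α) (W V : Finset (Finset α)) (hW : IsUpperSet (W : Set (Finset α)))
    (hV : IsUpperSet (V : Set (Finset α))) :
    #(Y.powerset.filter fun z => (z ∈ W ∧ Y \ z ∈ V) ∧ 2 ≤ #(Y \ z))
      ≤ #(Y.powerset.filter fun u => (u ∈ W ∧ u ∈ V) ∧ 2 ≤ #u) := by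
  have h := card_cross_le_card_diag Y W (V.filter fun z => 2 ≤ #z) hW (isUpperSet_filter_card_le V hV 2)
  have e1 : (Y.powerset.filter fun z => z ∈ W ∧ Y \ z ∈ V.filter (fun z => 2 ≤ #z)) =
      Y.powerset.filter fun z => (z ∈ W ∧ Y \ z ∈ V) ∧ 2 ≤ #(Y \ z) := by
    ext z; simp only [mem_filter]; tauto
  have e2 : (Y.powerset.filter fun u => u ∈ W ∧ u ∈ V.filter (fun z => 2 ≤ #z)) =
      Y.powerset.filter fun u => (u ∈ W ∧ u ∈ V) ∧ 2 ≤ #u := by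
    ext u; simp only [mem_filter]; tauto
  rw [e1, e2] at h
  exact h

/-- If `z ⊆ Y` and `p ∉ z` then `z ⊆ Y.erase p`. [folklore] -/
theorem subset_erase_of_not_mem {Y z : Finset α} {p : α} (hz : z ⊆ Y) (hp : p ∉ z) : z ⊆ Y.erase p :=
  subset_erase.2 ⟨hz, hp⟩

/-- **(RAB₂) inside `𝒫(Y)`.**  For up-sets `W, V` and a finset `Y` with `3 ≤ #Y`:
`#{z ⊆ Y : z ∈ W, Y \ z ∈ V, 2 ≤ #z, #z + 2 ≤ #Y} + #{i ∈ Y : {i} ∈ W ∩ V} ≤ #{u ⊆ Y : u ∈ W ∩ V, 2 ≤ #u}`. [this work] -/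
theorem card_window_add_singletons_le_rel (Y : Finset α) (W V : Finset (Finset α))
    (hW : IsUpperSet (W : Set (Finset α))) (hV : IsUpperSet (V : Set (Finset α))) (hY : 3 ≤ #Y) :
    #(Y.powerset.filter fun z => (z ∈ W ∧ Y \ z ∈ V) ∧ (2 ≤ #z ∧ #z + 2 ≤ #Y))
      + #(Y.filter fun i => ({i} : Finset α) ∈ W ∧ ({i} : Finset α) ∈ V)
      ≤ #(Y.powerset.filter fun u => (u ∈ W ∧ u ∈ V) ∧ 2 ≤ #u) := by
  set X := Y.powerset.filter fun z => (z ∈ W ∧ Y \ z ∈ V) ∧ (2 ≤ #z ∧ #z + 2 ≤ #Y) with hX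
  set I := Y.filter fun i => ({i} : Finset α) ∈ W ∧ ({i} : Finset α) ∈ V with hI
  set J := Y.filter fun i => ({i} : Finset α) ∈ V ∧ Y.erase i ∈ W with hJ
  set P := Y.powerset.filter fun u => (u ∈ W ∧ u ∈ V) ∧ 2 ≤ #u with hP
  set B := Y.powerset.filter fun z => (z ∈ W ∧ 2 ≤ #z) ∧ Y \ z ∈ V with hB
  have hGK : #B ≤ #P := card_cross_two_le Y W V hW hV
  have hsdY : ∀ i ∈ Y, Y \ Y.erase i = {i} := fun i hi => by
    rw [sdiff_erase hi, Finset.sdiff_self, insert_empty]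
  have hcardE : ∀ i ∈ Y, #(Y.erase i) = #Y - 1 := fun i hi => card_erase_of_mem hi
  have hXJ : #X + #J ≤ #B := by
    have hinj : Set.InjOn (fun i => Y.erase i) ↑J := by
      intro i hi j hj h
      rw [mem_coe, hJ, mem_filter] at hi hj
      exact (erase_inj Y hi.1).1 h
    rw [← card_image_of_injOn hinj, ← card_union_of_disjoint]
    · refine card_le_card fun z hz => ?_
      rw [mem_union] at hz
      rw [hB, mem_filter, mem_powerset]
      rcases hz with hz | hz
      · rw [hX, mem_filter, mem_powerset] at hz
        exact ⟨hz.1, ⟨hz.2.1.1, hz.2.2.1⟩, hz.2.1.2⟩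
      · rw [mem_image] at hz
        obtain ⟨i, hi, rfl⟩ := hz
        rw [hJ, mem_filter] at hi
        refine ⟨erase_subset i Y, ⟨hi.2.2, ?_⟩, ?_⟩
        · rw [hcardE i hi.1]; omega
        · rw [hsdY i hi.1]; exact hi.2.1
    · rw [disjoint_left]
      intro z hz hz'
      rw [hX, mem_filter] at hz
      rw [mem_image] at hz'
      obtain ⟨i, hi, rfl⟩ := hz'
      rw [hJ, mem_filter] at hi
      have := hcardE i hi.1
      omega
  by_cases hI0 : #I = 0
  · rw [hI0]; omega
  by_cases hI2 : 2 ≤ #I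
  · have hIJ : I ⊆ J := by
      intro i hi
      have hi' := hi
      rw [hI, mem_filter] at hi'
      obtain ⟨j, hj, hji⟩ := exists_mem_ne (by omega : 1 < #I) i
      rw [hI, mem_filter] at hj
      rw [hJ, mem_filter]
      have hsub : ({j} : Finset α) ⊆ Y.erase i := by
        rw [singleton_subset_iff, mem_erase]; exact ⟨hji, hj.1⟩
      exact ⟨hi'.1, hi'.2.2, hW hsub hj.2.1⟩
    have := card_le_card hIJ
    omega
  · have hI1 : #I = 1 := by omega
    obtain ⟨p, hIp⟩ := card_eq_one.1 hI1
    have hp : p ∈ Y ∧ ({p} : Finset α) ∈ W ∧ ({p} : Finset α) ∈ V := by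
      have : p ∈ I := by rw [hIp]; exact mem_singleton_self p
      rw [hI, mem_filter] at this
      exact this
    rw [hIp, card_singleton]
    by_cases hpc : Y.erase p ∈ W
    · have hpJ : p ∈ J := by rw [hJ, mem_filter]; exact ⟨hp.1, hp.2.2, hpc⟩
      have : 1 ≤ #J := card_pos.2 ⟨p, hpJ⟩
      omega
    · have hmem : ∀ z ∈ W, z ⊆ Y → p ∈ z := by
        intro z hz hzY
        by_contra h
        exact hpc (hW (subset_erase_of_not_mem hzY h) hz)
      obtain ⟨q, hqY, hqp⟩ := exists_mem_ne (by omega : 1 < #Y) p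
      set T := (Y.erase p).powerset.filter fun t => t ∈ V ∧ 2 ≤ #t with hT
      set P2 := Y.powerset.filter fun z => p ∈ z ∧ 2 ≤ #z with hP2
      have hP2P : P2 ⊆ P := by
        intro z hz
        rw [hP2, mem_filter, mem_powerset] at hz
        rw [hP, mem_filter, mem_powerset]
        have hsub : ({p} : Finset α) ⊆ z := singleton_subset_iff.2 hz.2.1
        exact ⟨hz.1, ⟨hW hsub hp.2.1, hV hsub hp.2.2⟩, hz.2.2⟩
      have hXT : #X ≤ #T := by
        have hinj : Set.InjOn (fun z => Y \ z) ↑X := by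
          intro z hz z' hz' h
          rw [mem_coe, hX, mem_filter, mem_powerset] at hz hz'
          simp only at h
          rw [← sdiff_sdiff_of_subset hz.1, h, sdiff_sdiff_of_subset hz'.1]
        rw [← card_image_of_injOn hinj]
        refine card_le_card fun t ht => ?_
        rw [mem_image] at ht
        obtain ⟨z, hz, rfl⟩ := ht
        rw [hX, mem_filter, mem_powerset] at hz
        rw [hT, mem_filter, mem_powerset]
        refine ⟨subset_erase_of_not_mem sdiff_subset ?_, hz.2.1.2, ?_⟩
        · rw [mem_sdiff, not_and, not_not]; intro; exact hmem z hz.2.1.1 hz.1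
        · rw [card_sdiff_of_subset hz.1]; omega
      have hTP : #T + 1 ≤ #P2 := by
        have hinj : Set.InjOn (fun t : Finset α => insert p t) ↑T := by
          intro t ht t' ht' h
          rw [mem_coe, hT, mem_filter, mem_powerset, subset_erase] at ht ht'
          simp only at h
          rw [← erase_insert ht.1.2, h, erase_insert ht'.1.2]
        have hpq : ({p, q} : Finset α) ∈ P2 := by
          rw [hP2, mem_filter, mem_powerset, card_pair hqp.symm]
          refine ⟨?_, mem_insert_self _ _, le_rfl⟩
          rw [insert_subset_iff, singleton_subset_iff]; exact ⟨hp.1, hqY⟩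
        have hnot : ({p, q} : Finset α) ∉ T.image fun t => insert p t := by
          rw [mem_image]
          rintro ⟨t, ht, h⟩
          rw [hT, mem_filter, mem_powerset, subset_erase] at ht
          have hct : #(insert p t) = #t + 1 := card_insert_of_notMem ht.1.2
          rw [h, card_pair hqp.symm] at hct
          omega
        have hsubP : insert ({p, q} : Finset α) (T.image fun t => insert p t) ⊆ P2 := by
          intro u hu
          rw [mem_insert] at hu
          rcases hu with rfl | hu
          · exact hpq
          · rw [mem_image] at hu
            obtain ⟨t, ht, rfl⟩ := hu
            rw [hT, mem_filter, mem_powerset, subset_erase] at ht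
            rw [hP2, mem_filter, mem_powerset]
            refine ⟨?_, mem_insert_self p t, ?_⟩
            · rw [insert_subset_iff]; exact ⟨hp.1, ht.1.1⟩
            · rw [card_insert_of_notMem ht.1.2]; omega
        have h1 := card_le_card hsubP
        rw [card_insert_of_notMem hnot, card_image_of_injOn hinj] at h1
        omega
      have h3 := card_le_card hP2P
      omega

/-- **(SK₂) strict Kleitman inside `𝒫(Y)`.**  For up-sets `W, V` with `∅ ∉ V`, a finset `Y` with `3 ≤ #Y` and a point `p ∈ Y` whose singleton
is a common member: `#{z ⊆ Y : z ∈ W, 2 ≤ #z, Y \ z ∈ V} < #{u ⊆ Y : u ∈ W ∩ V, 2 ≤ #u}`. [this work] -/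
theorem card_cross_two_lt_rel (Y : Finset α) (W V : Finset (Finset α)) (hW : IsUpperSet (W : Set (Finset α)))
    (hV : IsUpperSet (V : Set (Finset α))) (hV0 : ∅ ∉ V) (hY : 3 ≤ #Y) {p : α} (hpY : p ∈ Y)
    (hpW : ({p} : Finset α) ∈ W) (hpV : ({p} : Finset α) ∈ V) :
    #(Y.powerset.filter fun z => (z ∈ W ∧ 2 ≤ #z) ∧ Y \ z ∈ V)
      < #(Y.powerset.filter fun u => (u ∈ W ∧ u ∈ V) ∧ 2 ≤ #u) := by
  set B := Y.powerset.filter fun z => (z ∈ W ∧ 2 ≤ #z) ∧ Y \ z ∈ V with hB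
  set A := Y.powerset.filter fun u => (u ∈ W ∧ u ∈ V) ∧ 2 ≤ #u with hA
  have hsupW : ∀ z : Finset α, p ∈ z → z ∈ W := fun z hz => hW (singleton_subset_iff.2 hz) hpW
  have hsupV : ∀ z : Finset α, p ∈ z → z ∈ V := fun z hz => hV (singleton_subset_iff.2 hz) hpV
  have hmemB : ∀ z, z ∈ B ↔ z ⊆ Y ∧ (z ∈ W ∧ 2 ≤ #z) ∧ Y \ z ∈ V := fun z => by
    rw [hB, mem_filter, mem_powerset]
  have hmemA : ∀ u, u ∈ A ↔ u ⊆ Y ∧ (u ∈ W ∧ u ∈ V) ∧ 2 ≤ #u := fun u => by rw [hA, mem_filter, mem_powerset]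
  have hpc : ∀ z : Finset α, p ∈ z → p ∉ Y \ z := fun z hz h => (mem_sdiff.1 h).2 hz
  have hne : ∀ t : Finset α, t ∈ V → 1 ≤ #t := fun t ht => by
    rw [Nat.one_le_iff_ne_zero, Ne, card_eq_zero]; rintro rfl; exact hV0 ht
  have hcardE : #(Y.erase p) = #Y - 1 := card_erase_of_mem hpY
  have hsdE : Y \ Y.erase p = {p} := by rw [sdiff_erase hpY, Finset.sdiff_self, insert_empty]
  have hinsY : ∀ t : Finset α, t ⊆ Y → insert p t ⊆ Y := fun t ht => insert_subset_iff.2 ⟨hpY, ht⟩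
  let φ : Finset α → Finset α := fun z =>
    if p ∈ z then (if Y \ z ∈ W ∧ 2 ≤ #(Y \ z) then Y \ z else insert p (Y \ z)) else insert p z
  have hφ1 : ∀ z, p ∉ z → φ z = insert p z := fun z hz => by simp only [φ, hz, if_false]
  have hφ2 : ∀ z, p ∈ z → (Y \ z ∈ W ∧ 2 ≤ #(Y \ z)) → φ z = Y \ z := fun z hz hc => by
    simp only [φ, hz, hc, and_self, if_true]
  have hφ3 : ∀ z, p ∈ z → ¬ (Y \ z ∈ W ∧ 2 ≤ #(Y \ z)) → φ z = insert p (Y \ z) := fun z hz hc => by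
    simp only [φ, hz, if_true, if_neg hc]
  have himage : ∀ z ∈ B, φ z ∈ A := by
    intro z hz
    rw [hmemB] at hz
    obtain ⟨hzY, ⟨hzW, hz2⟩, hzV⟩ := hz
    rw [hmemA]
    by_cases hpz : p ∈ z
    · by_cases hcW : Y \ z ∈ W ∧ 2 ≤ #(Y \ z)
      · rw [hφ2 z hpz hcW]; exact ⟨sdiff_subset, ⟨hcW.1, hzV⟩, hcW.2⟩
      · rw [hφ3 z hpz hcW]
        refine ⟨hinsY _ sdiff_subset, ⟨hsupW _ (mem_insert_self _ _), hV (subset_insert p (Y \ z)) hzV⟩, ?_⟩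
        have h1 := hne _ hzV
        rw [card_insert_of_notMem (hpc z hpz)]; omega
    · rw [hφ1 z hpz]
      refine ⟨hinsY _ hzY, ⟨hsupW _ (mem_insert_self _ _), hsupV _ (mem_insert_self _ _)⟩, ?_⟩
      rw [card_insert_of_notMem hpz]; omega
  have hinj : Set.InjOn φ ↑B := by
    intro z hz z' hz' h
    rw [mem_coe, hmemB] at hz hz'
    by_cases hpz : p ∈ z <;> by_cases hpz' : p ∈ z'
    · by_cases hc : Y \ z ∈ W ∧ 2 ≤ #(Y \ z) <;> by_cases hc' : Y \ z' ∈ W ∧ 2 ≤ #(Y \ z')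
      · rw [hφ2 z hpz hc, hφ2 z' hpz' hc'] at h
        rw [← sdiff_sdiff_of_subset hz.1, h, sdiff_sdiff_of_subset hz'.1]
      · rw [hφ2 z hpz hc, hφ3 z' hpz' hc'] at h
        exact absurd (h ▸ mem_insert_self p (Y \ z') : p ∈ Y \ z) (hpc z hpz)
      · rw [hφ3 z hpz hc, hφ2 z' hpz' hc'] at h
        exact absurd (h.symm ▸ mem_insert_self p (Y \ z) : p ∈ Y \ z') (hpc z' hpz')
      · rw [hφ3 z hpz hc, hφ3 z' hpz' hc'] at h
        have : Y \ z = Y \ z' := by rw [← erase_insert (hpc z hpz), h, erase_insert (hpc z' hpz')]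
        rw [← sdiff_sdiff_of_subset hz.1, this, sdiff_sdiff_of_subset hz'.1]
    · rw [hφ1 z' hpz'] at h
      by_cases hc : Y \ z ∈ W ∧ 2 ≤ #(Y \ z)
      · rw [hφ2 z hpz hc] at h
        exact absurd (h.symm ▸ mem_insert_self p z' : p ∈ Y \ z) (hpc z hpz)
      · rw [hφ3 z hpz hc] at h
        have hzc : Y \ z = z' := by rw [← erase_insert (hpc z hpz), h, erase_insert hpz']
        exact absurd ⟨hzc ▸ hz'.2.1.1, hzc ▸ hz'.2.1.2⟩ hc
    · rw [hφ1 z hpz] at h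
      by_cases hc' : Y \ z' ∈ W ∧ 2 ≤ #(Y \ z')
      · rw [hφ2 z' hpz' hc'] at h
        exact absurd (h ▸ mem_insert_self p z : p ∈ Y \ z') (hpc z' hpz')
      · rw [hφ3 z' hpz' hc'] at h
        have hzc : z = Y \ z' := by rw [← erase_insert hpz, h, erase_insert (hpc z' hpz')]
        exact absurd ⟨hzc ▸ hz.2.1.1, hzc ▸ hz.2.1.2⟩ hc'
    · rw [hφ1 z hpz, hφ1 z' hpz'] at h
      rw [← erase_insert hpz, h, erase_insert hpz']
  have hwit : ∃ w ∈ A, w ∉ B.image φ := by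
    by_cases hcpW : Y.erase p ∈ W
    · by_cases hcpV : Y.erase p ∈ V
      · refine ⟨Y.erase p, (hmemA _).2 ⟨erase_subset p Y, ⟨hcpW, hcpV⟩, by rw [hcardE]; omega⟩, ?_⟩
        rw [mem_image]; rintro ⟨z, hz, hzw⟩
        rw [hmemB] at hz
        have hpn : p ∉ Y.erase p := fun h => (mem_erase.1 h).1 rfl
        by_cases hpz : p ∈ z
        · by_cases hc : Y \ z ∈ W ∧ 2 ≤ #(Y \ z)
          · rw [hφ2 z hpz hc] at hzw
            have : z = {p} := by rw [← sdiff_sdiff_of_subset hz.1, hzw, hsdE]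
            rw [this, card_singleton] at hz; omega
          · rw [hφ3 z hpz hc] at hzw; exact hpn (hzw ▸ mem_insert_self p (Y \ z))
        · rw [hφ1 z hpz] at hzw; exact hpn (hzw ▸ mem_insert_self p z)
      · obtain ⟨q, hqY, hqp⟩ := exists_mem_ne (by omega : 1 < #Y) p
        refine ⟨{p, q}, (hmemA _).2 ⟨?_, ⟨hsupW _ (mem_insert_self _ _), hsupV _ (mem_insert_self _ _)⟩,
          by rw [card_pair hqp.symm]⟩, ?_⟩
        · rw [insert_subset_iff, singleton_subset_iff]; exact ⟨hpY, hqY⟩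
        rw [mem_image]; rintro ⟨z, hz, hzw⟩
        rw [hmemB] at hz
        by_cases hpz : p ∈ z
        · exact hcpV (hV (subset_erase_of_not_mem sdiff_subset (hpc z hpz)) hz.2.2)
        · rw [hφ1 z hpz] at hzw
          have hzq : z = {q} := by
            rw [← erase_insert hpz, hzw, erase_insert]
            rw [mem_singleton]; exact hqp.symm
          rw [hzq, card_singleton] at hz; omega
    · refine ⟨Y, (hmemA _).2 ⟨subset_refl Y, ⟨hsupW _ hpY, hsupV _ hpY⟩, by omega⟩, ?_⟩
      rw [mem_image]; rintro ⟨z, hz, hzw⟩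
      rw [hmemB] at hz
      by_cases hpz : p ∈ z
      · by_cases hc : Y \ z ∈ W ∧ 2 ≤ #(Y \ z)
        · rw [hφ2 z hpz hc] at hzw
          have : z = ∅ := by rw [← sdiff_sdiff_of_subset hz.1, hzw, Finset.sdiff_self]
          rw [this, card_empty] at hz; omega
        · rw [hφ3 z hpz hc] at hzw
          have hzc : Y \ z = Y.erase p := by
            rw [← erase_insert (hpc z hpz), hzw]
          have : z = {p} := by rw [← sdiff_sdiff_of_subset hz.1, hzc, hsdE]
          rw [this, card_singleton] at hz; omega
      · rw [hφ1 z hpz] at hzw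
        have hzc : z = Y.erase p := by rw [← erase_insert hpz, hzw]
        exact hcpW (hzc ▸ hz.2.1.1)
  obtain ⟨w, hwA, hwn⟩ := hwit
  have hsub : B.image φ ⊆ A.erase w := by
    intro u hu
    rw [mem_erase]
    refine ⟨fun h => hwn (h ▸ hu), ?_⟩
    rw [mem_image] at hu
    obtain ⟨z, hz, rfl⟩ := hu
    exact himage z hz
  have h1 := card_le_card hsub
  rw [card_image_of_injOn hinj, card_erase_of_mem hwA] at h1
  have h2 : 0 < #A := card_pos.2 ⟨w, hwA⟩
  omega

end Summit.CriticalPhenomena.PercolationContinuityZ3.Theorems.ThresholdTwoFibre
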